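import Mathlib
import HarnessLib

/-!
# Route `DiophantineDichotomy`, crux `KhovanskiiApproxTypeEv` (stmt-Schanuel-14972), line `lambert-liouville-kill`:
# stub `stub_liouvilleWindowInt` — Liouville scales with integer numerators inside a window

Crux `Summit.Schanuel.Schanuel.Theses.DiophantineDichotomy.KhovanskiiApproxTypeEv` (item stmt-Schanuel-14972),
certificate line `lambert-liouville-kill` (skeleton `Cruxes/KhovanskiiApproxTypeEv/Lines/lambert_liouville_kill.lean`,
lead `prover-line-stmt-Schanuel-14972-a1-0`), registered stub `stub_liouvilleWindowInt` (landed `--supports stmt-Schanuel-14972`).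

A Liouville number `x` has, for every exponent `m`, every threshold `N` and every radius `δ > 0`, a
rational `p/q` (`p : ℤ`, `q : ℕ`, `q ≥ N`, `q ≥ 1`) with `|x − p/q| ≤ q^{−m}` and `|x − p/q| < δ`.
In the exp-rational extension of the certificate (`notLiouville_expRational_of_ev`, consuming STUB F2)
these are the Liouville scales `q` of `x` at which the challenger is built; the integer numerator `p`
(of either sign) is needed since `x` is no longer assumed positive.  Proof: Mathlib's
`Liouville.frequently_exists_num (m+1)` gives `a/b` with `|x − a/b| < b^{−(m+1)}` frequently in
`b : ℕ`; intersect (`Filter.Frequently.and_eventually`) with the eventual conditions `b ≥ N`, `b ≥ 1`,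
`1/b < δ` (`tendsto_one_div_atTop_nhds_zero_nat`).  Then `b^{−(m+1)} ≤ b^{−m}` and
`b^{−(m+1)} ≤ 1/b < δ`.  Pure Mathlib; no tree inputs.
-/

noncomputable section

-- `Summit.Schanuel.Schanuel.…` is the mandated summit/sub-problem namespace (single-conjunct summit), hence:
set_option linter.dupNamespace false

namespace Summit.Schanuel.Schanuel.Cruxes.KhovanskiiApproxTypeEv.LambertLiouvilleKill

open Polynomial Filter Topology

/-- **STUB F2 (Liouville scales with integer numerators, inside a window).**  A Liouville number `x`
has, for every exponent `m`, threshold `N` and radius `δ > 0`, a rational `p/q` (`p ∈ ℤ`, `q ≥ N`,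
`q ≥ 1`) with `|x − p/q| ≤ q^{−m}` and `|x − p/q| < δ`.  Proof: Mathlib's
`Liouville.frequently_exists_num (m+1)` intersected (`Filter.Frequently.and_eventually`) with the
eventual conditions `b ≥ N`, `b ≥ 1`, `1/b < δ` (`tendsto_one_div_atTop_nhds_zero_nat`); then
`1/q^{m+1} ≤ 1/q^m` and `1/q^{m+1} ≤ 1/q < δ`. [folklore] -/
theorem stub_liouvilleWindowInt :
    ∀ (x δ : ℝ), Liouville x → 0 < δ → ∀ (m N : ℕ),
      ∃ (p : ℤ) (q : ℕ), N ≤ q ∧ 1 ≤ q ∧ |x - (p : ℝ) / q| ≤ 1 / (q : ℝ) ^ m ∧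
        |x - (p : ℝ) / q| < δ := by
  intro x δ hL hδ0 m N
  -- eventual side conditions on the denominator, met frequently by Liouville denominators
  have hev : ∀ᶠ b : ℕ in atTop, N ≤ b ∧ 1 ≤ b ∧ 1 / (b : ℝ) < δ :=
    (eventually_ge_atTop N).and ((eventually_ge_atTop 1).and
      ((tendsto_one_div_atTop_nhds_zero_nat (𝕜 := ℝ)).eventually (eventually_lt_nhds hδ0)))
  obtain ⟨b, ⟨a, -, hlt⟩, hNb, h1b, hbδ⟩ :=
    ((hL.frequently_exists_num (m + 1)).and_eventually hev).exists
  have hb1 : (1 : ℝ) ≤ b := by exact_mod_cast h1b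
  have hb0 : (0 : ℝ) < b := by linarith
  -- the approximation lies inside the window `|x - a/b| < δ`
  have hpow : 1 / (b : ℝ) ^ (m + 1) ≤ 1 / (b : ℝ) :=
    one_div_le_one_div_of_le hb0 (by
      calc (b : ℝ) = (b : ℝ) ^ 1 := (pow_one _).symm
        _ ≤ (b : ℝ) ^ (m + 1) := pow_le_pow_right₀ hb1 (by omega))
  have hwin : |x - a / b| < δ := lt_of_lt_of_le hlt (hpow.trans hbδ.le)
  -- precision: `1/b^(m+1) ≤ 1/b^m`
  have hpow' : 1 / (b : ℝ) ^ (m + 1) ≤ 1 / (b : ℝ) ^ m :=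
    one_div_le_one_div_of_le (pow_pos hb0 m) (pow_le_pow_right₀ hb1 (Nat.le_succ m))
  exact ⟨a, b, hNb, h1b, hlt.le.trans hpow', hwin⟩

end Summit.Schanuel.Schanuel.Cruxes.KhovanskiiApproxTypeEv.LambertLiouvilleKill

end
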